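import Mathlib.MeasureTheory.Integral.Bochner.Basic
import Mathlib.Topology.MetricSpace.HolderNorm
import Mathlib.Algebra.Ring.Periodic
import Literature.Analysis.FunctionSpaces.FlatTorus
import Literature.Analysis.FunctionSpaces.TorusCalculus
import Literature.Analysis.FunctionSpaces.TorusFluidGlue
import Literature.Analysis.FunctionSpaces.HolderNorm
import Literature.Analysis.FunctionSpaces.TorusSobolevNorm
import Literature.Analysis.FunctionSpaces.Complexify
import Literature.Analysis.FluidPDE.PassiveVector
import HarnessLib

/-!
# Lattice shear words and fractal shear carriers on the flat 3-torus (notions)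

Definitions only. A LATTICE SHEAR WORD is a finite time-periodic sequence of frozen Kolmogorov layers
`x ↦ (sin(2π m·x + φ)/(2π|m|)) ê` (`m ∈ ℤ³ ∖ 0`, `ê ⊥ m`, unit maximal shear rate) on the unit 3-torus, each played for a slot
duration `τ_j` — the building block of Armstrong–Vicol's fractal carrier (alternating shear flows, arXiv:2305.05048 §3) and of
renovating / alternating-shear models of transport (Zel'dovich's renovating flow; Meshalkin–Sinai's Kolmogorov flow).  A FRACTAL
SHEAR CARRIER replays one word design at a sequence of levels (cells of size `1/N_m`, shear rates `a_m`) — AV's construction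
schema with its bookkeeping sequences made explicit; `Permissible` lists the parameter inequalities (transposed from AV (3.42)–(3.43)
to the solenoidal-vector cell law `1 + c/ν_cell²`), `Regular` the regularity of the summed carrier, `RenormalisationBound` the
output of the iteration along the tuned viscosities `ν_j = kbar j`.  `SolenoidalWordDecay` / `WordGainAtRate` are the cell-level
decay properties of the passive solenoidal vector (`Torus.IsWeakPassiveVectorOn 0`) around the word's cells.
Provenance: definition item `defn-LatticeShearWords` (cell `ad-ideate`, seat ad-p1, route
`SolenoidalFractalHomogenisation`; draft `run/shared/lean/pub/ad-ideate/ad-ideate-p1/route/LatticeShearWords.lean`,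
joint check with `PassiveVector.lean` in `route/RouteSketch.lean` §A+§B, rc 0); landed verbatim up to docstring tags by
the cell's literature seat.  Definitions only — no statements, no named facts, no axioms.
[cite: ArmstrongVicol2025, §3 (fractal alternating-shear carrier; parameter bookkeeping (3.42)-(3.43))]
[cite: MeshalkinSinai1961, pp. 1700–1705 (Kolmogorov shear layer)] -/

namespace Literature.Analysis.FluidPDE.LatticeShear

noncomputable section

open MeasureTheory Set Filter Topology Complex
open scoped InnerProductSpace ENNReal NNReal Real
open Literature.Analysis Literature.Analysis.FunctionSpaces Literature.Analysis.FluidPDE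

/-- One phase of a lattice shear word: lattice vector `m ≠ 0`, unit polarisation `e ⊥ m`, slot duration `τ > 0`, phase `φ`
(cell `ad-ideate` ROUND-2 Sketch §5 `AdIdeate.P1.LatticePhase`; one frozen Kolmogorov layer of Armstrong–Vicol's
alternating-shear carrier). [cite: ArmstrongVicol2025, §3 (alternating-shear fractal carrier)] -/
structure LatticePhase where
  m : Fin 3 → ℤ
  e : EuclideanSpace ℝ (Fin 3)
  τ : ℝ
  φ : ℝ
  m_ne : m ≠ 0
  e_unit : ‖e‖ = 1
  e_perp : ⟪e, Torus.latticeVec m⟫_ℝ = 0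
  τ_pos : 0 < τ

/-- The frozen layer of a phase on the unit 3-torus: `(sin(2π m·x + φ)/(2π|m|)) ê` (unit maximal shear rate) — the
Kolmogorov shear layer. [cite: MeshalkinSinai1961, pp. 1700–1705] -/
def LatticePhase.layer (P : LatticePhase) (x : UnitAddTorus (Fin 3)) : EuclideanSpace ℝ (Fin 3) :=
  ((UnitAddTorus.mFourier P.m x * Complex.exp (P.φ * I)).im / (2 * π * ‖Torus.latticeVec P.m‖)) • P.e

/-- A lattice shear word with `k ≥ 1` phases and a slot RAMP fraction `ρ ∈ (0, 1/2]`: each layer is faded in over the first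
`ρ τ_j` of its slot and out over the last `ρ τ_j` (continuous trapezoidal envelope — Armstrong–Vicol's smooth time cut-offs in their
simplest Lipschitz form; it makes `t ↦ carrier t` continuous with values in every `C^{0,α}`, as the leaf's `ContinuousInHolderOn`
demands; the ROUND-2 census used the sharp limit `ρ → 0`). [cite: ArmstrongVicol2025, §3 (alternating-shear fractal carrier)] -/
structure LatticeWord (k : ℕ) where
  phase : Fin k → LatticePhase
  ramp : ℝ
  pos : 0 < k
  ramp_pos : 0 < ramp
  ramp_le : ramp ≤ 1 / 2

namespace LatticeWord
variable {k : ℕ}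
/-- Period of the word (sum of the slot durations). [folklore] -/
def period (W : LatticeWord k) : ℝ := ∑ i, (W.phase i).τ
/-- Start time of phase `j` within one period. [folklore] -/
def start (W : LatticeWord k) (j : Fin k) : ℝ := ∑ i ∈ Finset.univ.filter (· < j), (W.phase i).τ
/-- Trapezoidal slot envelope: `0` outside `[a, a + τ]`, linear ramps of length `ρ τ` at both ends, `1` in between. [folklore] -/
def trapezoid (a τ ρ s : ℝ) : ℝ := max 0 (min 1 (min ((s - a) / (ρ * τ)) ((a + τ - s) / (ρ * τ))))
/-- The time-periodic, time-continuous carrier of the word: in slot `j` the layer of phase `j`, faded in/out by the envelope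
(Armstrong–Vicol's alternating shears with time cut-offs). [cite: ArmstrongVicol2025, §3 (alternating-shear fractal carrier)] -/
def carrier (W : LatticeWord k) (t : ℝ) (x : UnitAddTorus (Fin 3)) : EuclideanSpace ℝ (Fin 3) :=
  let r := Int.fract (t / W.period) * W.period
  ∑ j, trapezoid (W.start j) (W.phase j).τ W.ramp r • (W.phase j).layer x
/-- The carrier rescaled to cell size `1/n` (unit shear rate kept): `(1/n)·B(t, n·x)`. [folklore] -/
def cell (W : LatticeWord k) (n : ℕ) (t : ℝ) (x : UnitAddTorus (Fin 3)) : EuclideanSpace ℝ (Fin 3) :=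
  (1 / (n : ℝ)) • W.carrier t (n • x)
/-- The same word with every slot duration multiplied by `s > 0` (quasi-static replay: `s ∝ 1/ν`). [folklore] -/
def stretch (W : LatticeWord k) (s : ℝ) (hs : 0 < s) : LatticeWord k where
  phase j := { (W.phase j) with τ := s * (W.phase j).τ, τ_pos := mul_pos hs (W.phase j).τ_pos }
  ramp := W.ramp
  pos := W.pos
  ramp_pos := W.ramp_pos
  ramp_le := W.ramp_le
end LatticeWord

/-- Uniform energy decay of the PASSIVE SOLENOIDAL (A = 0) cell evolution around the `1/n`-cells of the word `W` at
molecular viscosity `ν/n²`, at the rate of the gravest unit-torus shell under viscosity `Q·ν/n²`, for all cells `n ≥ n₀`,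
all `H¹` divergence-free mean-zero data, with a transient constant `C` (the A0 twin of `AdIdeate.P1.PositiveStableLatticeWord`;
`Q = 1, C = 1` holds for every word by the energy identity — ROUND-2 Lemma 1.6). The cell-level input that
Armstrong–Vicol's iteration consumes, transposed from the scalar to the passive solenoidal vector. [cite: ArmstrongVicol2025, §3 (alternating-shear fractal carrier)] -/
def SolenoidalWordDecay {k : ℕ} (W : LatticeWord k) (ν Q C : ℝ) (n₀ : ℕ) : Prop :=
  ∀ n ≥ n₀, ∀ w₀ : UnitAddTorus (Fin 3) → EuclideanSpace ℝ (Fin 3),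
    FunctionSpaces.Torus.MemSobolev 1 (FunctionSpaces.EuclideanSpace.complexify ∘ w₀) →
    Torus.IsWeaklyDivFree w₀ → Torus.HasZeroMean w₀ →
    ∀ T > (0:ℝ), ∀ w, Torus.IsWeakPassiveVectorOn 0 T (ν / (n:ℝ) ^ 2) (W.cell n) w₀ w →
      ∀ᵐ t ∂(volume.restrict (Ioo 0 T)),
        ∫ x, ‖w t x‖ ^ 2 ≤ C * Real.exp (-(8 * π ^ 2 * Q * ν / (n:ℝ) ^ 2) * t) * ∫ x, ‖w₀ x‖ ^ 2

/-- The quasi-static gain of a word `W` with constant `c`, valid for cell viscosities `ν < ν₀`, delivered with an EXPLICIT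
homogenisation threshold and transient constant of polynomial shape `K/ν^p` (the quantitative content Armstrong–Vicol's
iteration consumes: how many cells per large-scale period, and how large a transient, at cell Péclet number `1/ν`).
[cite: ArmstrongVicol2025, §3 (alternating-shear fractal carrier)] -/
def WordGainAtRate {k : ℕ} (W : LatticeWord k) (c ν₀ K p : ℝ) : Prop :=
  ∀ ν, ∀ hν : ν ∈ Ioo 0 ν₀,
    SolenoidalWordDecay (W.stretch (1 / ν) (by simp [hν.1])) ν (1 + c / ν ^ 2) (K / ν ^ p) ⌈K / ν ^ p⌉₊

/-- The second-order (Taylor) excess-viscosity quadratic form of ONE slot of a lattice word acting on the passive solenoidal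
vector (`A = 0`), per unit `1/ν` and at unit shear rate, evaluated at a unit large-scale direction `q` and a polarisation `p ⊥ q`:
`τ · (ê·q)² · (‖p‖² − (p · P_q m̂)²) / (2 (2π|m|)⁴)` with `m̂ = m/|m|` and `P_q` the projection orthogonal to `q`, in the conventions of
`LatticePhase.layer` (unit torus, unit maximal shear rate, velocity amplitude `1/(2π|m|)`): the cell corrector of a steady parallel
shear is explicit (Taylor dispersion: scalar excess `⟨U²⟩/(ν(2π|m|)²) = 1/(2ν(2π|m|)⁴)` along `ê`; for the vector problem the Leray
projection removes the polarisation component along `P_q m̂` — ROUND-2 Lemma 1.1, A = 0). This is the NOMINAL slot constant — the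
steady layer at FULL amplitude for the whole slot duration `τ`: `c · period = Σ_j slotGain` on the mode `(q, p)` is the nominal
Taylor constant `c` of the word (`IsotropicWordGain`). The word's `carrier` runs each slot under the trapezoid envelope
`trapezoid (start j) τ_j ramp` (linear ramps of length `ramp·τ_j`), and the corrector of a time-modulated layer starts up with the
kernel `e^{-λ(s-s')}`, `λ = ν(2π|m|)²`; the quasi-statically REALISED weight of slot `j` is therefore `ϑ(ramp, T_j)·slotGain_j` with
`ϑ(ρ,T) = (λ/L)∫₀ᴸ a(s)∫₀ˢ e^{-λ(s-s')} a(s') ds' ds → ⨍ a² = 1 - 4ρ/3` as `T = λL → ∞` (lag `O(T⁻²)` for the ramped envelope,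
`ϑ = 1 - (1 - e^{-T})/T` for a sharp slot): the ramped replay realises `(1 - 4·ramp/3)×` the nominal constant in the long-slot
limit (`= 1/3` of it at `ramp = 1/2`) — cell ad-ideate ROUND-12, finding F12 (kit j272729: 0.33333 / 0.66666 / 0.93332 at
`ρ = 1/2, 1/4, 0.05`). Armstrong–Vicol carry the same envelope factor: their time cutoff is normalised by `∫ζ² = 9/10` and the
one-step renormalisation reads `K̄ ≈ κ + 9a²ε⁴/(80κ)`, with start-up lag `Cε⁴/(κ²τ)`. The enhancement factor `Q = 1 + c/ν²` of
`WordGainAtRate W c …` is thus to be fed the REALISED constant (route item `RealisedQuasiStaticCellLaw`: two-sided bracket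
around `c_W = (1 - 4·ramp/3)·c₀`), not the nominal one. (Added 2026-08-25; realised-vs-nominal wording 2026-08-27, definitions
unchanged.) [cite: ArmstrongVicol2025, §4 p. 17 (time cutoff, ∫ζ² = 9/10) and p. 31 (K̄ ≈ κ + 9a²ε⁴/(80κ); start-up lag Cε⁴/(κ²τ))] -/
def slotGain (P : LatticePhase) (q p : EuclideanSpace ℝ (Fin 3)) : ℝ :=
  let mv := Torus.latticeVec P.m
  let mh := (1 / ‖mv‖) • mv
  let mp := mh - ⟪mh, q⟫_ℝ • q
  P.τ * (1 / (2 * (2 * π * ‖mv‖) ^ 4)) * ⟪P.e, q⟫_ℝ ^ 2 * (‖p‖ ^ 2 - ⟪p, mp⟫_ℝ ^ 2)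

/-- A word design `W` is ISOTROPIC WITH (NOMINAL) TAYLOR CONSTANT `c₀` when its slot-summed second-order form is EXACTLY
`c₀ · period` for every unit large-scale direction `q` and every unit divergence-free polarisation `p ⊥ q` — the nominal,
steady-layer full-amplitude constant of `slotGain`; the leading-order time-averaged effective viscosity of the quasi-statically
replayed RAMPED word at cell viscosity `ν` is then the scalar `ν(1 + c_W/ν²)` on divergence-free fields with the REALISED constant
`c_W = (1 - 4·W.ramp/3)·c₀` in the long-slot limit (every slot carries the same envelope factor `⨍a² = 1 - 4·ramp/3`, so isotropy
is inherited and only the constant is rescaled; `slotGain` docstring, ROUND-12 F12). Spherical-design words achieve it — e.g. the 13 lattice directions {axes, face and body diagonals} × both polarisations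
with slot durations ∝ (26-point degree-7 cubature weight 40 : 32 : 27) × |m|⁴, for which only the isotropic second and mixed fourth
moments of the direction set enter; axis-aligned words do not (the form degenerates in the axis sectors). Exactness (not a lower bound) is what the renormalisation cascade
consumes: the Taylor map `x ↦ x + B/x` is decreasing in the quasi-static regime, so only two-sided knowledge of each level's
enhancement propagates up the levels (Armstrong–Vicol, Lemma 3.4). [cite: ArmstrongVicol2025, Lemma 3.4 (two-sided control of the renormalized diffusivities)] -/
def IsotropicWordGain {k : ℕ} (W : LatticeWord k) (c₀ : ℝ) : Prop :=
  ∀ q p : EuclideanSpace ℝ (Fin 3), ‖q‖ = 1 → ‖p‖ = 1 → ⟪p, q⟫_ℝ = 0 → ∑ j, slotGain (W.phase j) q p = c₀ * W.period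

/-- The bookkeeping data of a fractal (multi-level) carrier built from ONE word design replayed at every level:
level `m ≥ 1` has `N m` cells per unit length (`N 0 = 1`), shear rate `a m`, slot durations stretched to the quasi-static
regime of its own renormalised cell viscosity, and `kbar m` is the renormalised ("effective") viscosity felt at scales between
levels `m` and `m+1` — the molecular viscosities along which dissipation is claimed are `ν_j := kbar j` (Armstrong–Vicol tune
`κ_j` to the construction in exactly this way). Pure data + positivity; the constraints are `Permissible`, the analysis is
`Regular`. New object posited by this route (interface only; existence is the crux `PermissibleFractalCarrier`).
[cite: ArmstrongVicol2025, §3 (fractal carrier; bookkeeping (3.42)–(3.43))] -/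
structure FractalCarrierData (k : ℕ) where
  design : LatticeWord k
  gain : ℝ
  nu0 : ℝ
  K : ℝ
  N : ℕ → ℕ
  a : ℕ → ℝ
  kbar : ℕ → ℝ
  gain_pos : 0 < gain
  nu0_pos : 0 < nu0
  K_pos : 0 < K
  N_pos : ∀ m, 0 < N m
  a_pos : ∀ m, 0 < a m
  kbar_pos : ∀ m, 0 < kbar m

namespace FractalCarrierData
variable {k : ℕ}

/-- Cell-unit viscosity of level `m` when the ambient (renormalised) viscosity is `kbar m`: `kbar_m N_m² / a_m`. [folklore] -/
def cellVisc (D : FractalCarrierData k) (m : ℕ) : ℝ := D.kbar m * (D.N m : ℝ) ^ 2 / D.a m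

/-- Positivity of the cell viscosity. [folklore] -/
private theorem cellVisc_pos (D : FractalCarrierData k) (m : ℕ) : 0 < D.cellVisc m := by
  unfold cellVisc
  exact div_pos (mul_pos (D.kbar_pos m) (by have := D.N_pos m; positivity)) (D.a_pos m)

/-- Quasi-static slot stretch of level `m`: `1 / cellVisc m`. [folklore] -/
def slotStretch (D : FractalCarrierData k) (m : ℕ) : ℝ := 1 / D.cellVisc m

/-- Positivity of the slot stretch. [folklore] -/
private theorem slotStretch_pos (D : FractalCarrierData k) (m : ℕ) : 0 < D.slotStretch m :=
  one_div_pos.mpr (D.cellVisc_pos m)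

/-- The level-`m` word: the design with slots stretched quasi-statically. [folklore] -/
def word (D : FractalCarrierData k) (m : ℕ) : LatticeWord k := D.design.stretch (D.slotStretch m) (D.slotStretch_pos m)

/-- Physical time period of level `m`: (word period in turnover units) / (shear rate). [folklore] -/
def physPeriod (D : FractalCarrierData k) (m : ℕ) : ℝ := (D.word m).period / D.a m

/-- The level-`m` velocity field: shear rate `a m`, cells of size `1/N m`, time in turnover units `a m · t`. [cite: ArmstrongVicol2025, §3 (alternating-shear fractal carrier)] -/
def level (D : FractalCarrierData k) (m : ℕ) (t : ℝ) (x : UnitAddTorus (Fin 3)) : EuclideanSpace ℝ (Fin 3) :=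
  D.a m • (D.word m).cell (D.N m) (D.a m * t) x

/-- The carrier: the sum of the levels `m ≥ 1` (pointwise `tsum`; summability is part of `Regular`) — Armstrong–Vicol's
fractal carrier schema. [cite: ArmstrongVicol2025, §3 (alternating-shear fractal carrier)] -/
def carrier (D : FractalCarrierData k) (t : ℝ) (x : UnitAddTorus (Fin 3)) : EuclideanSpace ℝ (Fin 3) :=
  ∑' m : ℕ, D.level (m + 1) t x

/-- PERMISSIBILITY — the parameter inequalities of the cascade (the list extracted from Armstrong–Vicol (3.42)–(3.43) /
§5 in ROUND-1/2, transposed to the solenoidal-vector cell law): nested lattices with super-geometric separation; the Taylor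
recursion `kbar_{m} = kbar_{m+1} (1 + c a_{m+1}² /(kbar_{m+1}² N_{m+1}⁴))` (cell-unit gain `1 + c/ν_cell²`); every level in
the quasi-static regime of the word gain (`ν_cell < ν₀`); separation beating the homogenisation threshold `⌈K/ν_cell⌉`;
levels finer than the active one viscous-dominated; commensurable periods (time-periodicity of the sum); `kbar_j → 0`.
[cite: ArmstrongVicol2025, §3 (3.42)–(3.43) (parameter bookkeeping, transposed)] -/
def Permissible (D : FractalCarrierData k) : Prop :=
  D.N 0 = 1 ∧ (∀ m, D.N m ∣ D.N (m + 1)) ∧ (∀ m, 2 * D.N m ≤ D.N (m + 1)) ∧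
  (∀ m, D.kbar m = D.kbar (m + 1) * (1 + D.gain * D.a (m + 1) ^ 2 / (D.kbar (m + 1) ^ 2 * (D.N (m + 1) : ℝ) ^ 4))) ∧
  (∀ m, 1 ≤ m → D.cellVisc m < D.nu0) ∧
  (∀ m, (⌈D.K / D.cellVisc (m + 1)⌉₊ : ℝ) * D.N m ≤ D.N (m + 1)) ∧
  (∀ j m, 1 ≤ j → j < m → 1 ≤ D.kbar j * (D.N m : ℝ) ^ 2 / D.a m) ∧
  (∀ m, ∃ r : ℕ, 0 < r ∧ (r : ℝ) * D.physPeriod (m + 1) = D.physPeriod m) ∧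
  Tendsto D.kbar atTop (𝓝 0)

/-- REGULARITY of the summed carrier (the analytic half of the construction): the level series converges pointwise, the sum is
`C_t C^{0,α}_x` for some `α > 0`, time-periodic, and weakly divergence free at every time.
[cite: ArmstrongVicol2025, Thm. 1.1 (regularity class of the carrier)] -/
def Regular (D : FractalCarrierData k) : Prop :=
  (∀ t x, Summable fun m => D.level (m + 1) t x) ∧
  ∃ α : ℝ≥0, 0 < α ∧ FunctionSpaces.ContinuousInHolderOn univ α D.carrier ∧
    (∃ τ : ℝ, 0 < τ ∧ Function.Periodic D.carrier τ) ∧ ∀ t, Torus.IsWeaklyDivFree (D.carrier t)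

/-- The OUTPUT of the renormalisation along the tuned viscosities `ν_j = kbar j`: for every length-scale class `R`, a fixed
fraction `η = η(R) > 0` of the energy of every `H¹` divergence-free mean-zero datum of that class is gone by time `1/2`,
uniformly in `j ≥ j₀(R)` and in the weak solution. The fraction depends on the class, exactly as the rate `ϱ(d, θ₀)` of
Armstrong–Vicol's Thm. 1.1 depends on the length scale `‖θ₀‖_{L²}/‖θ₀‖_{H¹}` (their cascade is harvested from the datum's
scale downwards, Prop. 5.2 and §5.4; a class-independent rate is only announced, §1.3 — see the correction note on
`TurbPassiveScalar.armstrong_vicol`).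
**Correction (2026-08-25, before first use; same change-set adds `slotGain` / `IsotropicWordGain` above).** The landed version read `∃ η > 0, ∀ R, ∃ j₀, …` (one fraction for all
length-scale classes), which is more than the transposed method delivers and would have made the renormalisation crux of the
using route strictly harder than Armstrong–Vicol's theorem; the quantifiers are now `∀ R, ∃ η > 0, ∃ j₀, ∀ j ≥ j₀`. Name and
(absent) users unchanged. [cite: ArmstrongVicol2025, Thm. 1.1 (shape of the conclusion, transposed to the passive solenoidal vector)] -/
def RenormalisationBound (D : FractalCarrierData k) : Prop :=
  ∀ R : ℝ≥0, ∃ η > (0:ℝ), ∃ j₀ : ℕ, ∀ j ≥ j₀, ∀ w₀ : UnitAddTorus (Fin 3) → EuclideanSpace ℝ (Fin 3),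
    FunctionSpaces.Torus.MemSobolev 1 (FunctionSpaces.EuclideanSpace.complexify ∘ w₀) →
    Torus.HasZeroMean w₀ → Torus.IsWeaklyDivFree w₀ →
    Torus.eGradNormSq w₀ ≤ (R : ℝ≥0∞) * ENNReal.ofReal (Torus.vectorL2Sq w₀) →
    ∀ w, Torus.IsWeakPassiveVectorOn 0 1 (D.kbar j) D.carrier w₀ w →
      ∀ᵐ t ∂(volume.restrict (Ioo (1/2 : ℝ) 1)), ∫ x, ‖w t x‖ ^ 2 ≤ (1 - η) * ∫ x, ‖w₀ x‖ ^ 2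

end FractalCarrierData

/-! ### A concrete phase and word (carrier non-emptiness)
`LatticeWord k` is non-empty for every `k ≥ 1` (and empty for `k = 0` by the field `pos : 0 < k`, so the `k = 0`
instances of statements quantified over `W : LatticeWord k` are vacuous and harmless).  The witness is the
Kolmogorov layer `m = (1,0,0)`, `ê = (0,1,0)` (`sin(2πx₁) ê₂`, unit slot, phase `0`) replayed in every slot with
ramp `1/2` (cell `ad-ideate`, seat ad-p1, carrier-witness addendum `route/LatticeShearWords-addendum-witness.lean`,
sha256 f98dbf1f…; landed verbatim up to docstring tags). -/

/-- The phase `m = (1,0,0)`, `e = (0,1,0)`, `τ = 1`, `φ = 0`: the Kolmogorov shear layer `sin(2π x₁) ê₂`.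
[cite: MeshalkinSinai1961, pp. 1700–1705 (Kolmogorov shear layer)] -/
def examplePhase : LatticePhase where
  m := fun i => if i = 0 then 1 else 0
  e := EuclideanSpace.single 1 (1 : ℝ)
  τ := 1
  φ := 0
  m_ne := by
    intro h
    have := congrArg (fun f => f 0) h
    simp at this
  e_unit := by
    simp
  e_perp := by
    rw [EuclideanSpace.inner_single_left]
    simp [Torus.latticeVec_apply]
  τ_pos := one_pos

/-- A one-slot word (ramp `1/2`) playing `examplePhase`. [cite: ArmstrongVicol2025, §3 (alternating-shear fractal carrier: one shear slot)] -/
def exampleWord : LatticeWord 1 where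
  phase := fun _ => examplePhase
  ramp := 1 / 2
  pos := Nat.one_pos
  ramp_pos := by norm_num
  ramp_le := le_refl _

/-- `LatticeWord 1` is non-empty. [cite: ArmstrongVicol2025, §3 (alternating-shear fractal carrier)] -/
theorem latticeWord_nonempty : Nonempty (LatticeWord 1) := ⟨exampleWord⟩

/-- `LatticeWord k` is non-empty for every `k ≥ 1` (the same layer in every slot). [cite: ArmstrongVicol2025, §3 (alternating-shear fractal carrier)] -/
theorem latticeWord_nonempty_of_pos (k : ℕ) (hk : 0 < k) : Nonempty (LatticeWord k) :=
  ⟨{ phase := fun _ => examplePhase, ramp := 1 / 2, pos := hk, ramp_pos := by norm_num, ramp_le := le_refl _ }⟩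

end

end Literature.Analysis.FluidPDE.LatticeShear
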